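import Summits.QuantumAdvantage.QuantumAdvantage.Theorems.WalkTwoStepTransferMarkov

/-!
# (G♯) local engine — toward `DensePinned p`: trajectories of the generic automaton, and the WALK AUTOMATON with a bit register

Cell qa-qnc0, rung (G♯) = item stmt-QuantumAdvantage-23121 (planner qa-qnc0-p2 g24, ask P2-24b); prover qn-prover-3 g15.

* `traj` / `pathVal_eq_prod_traj`: the signed path value of `WalkTwoStepTransferAutomaton.pathVal` is the product of the edge weights along
  the deterministic trajectory times the final weight — the form in which a strategy's `(−1)^{#status}` will be matched step by step.
* The WALK AUTOMATON WITH A `d`-BIT REGISTER (the planner's enlarged state `ℤ_{M+1} × {0,1}^{d}`, ROUND-24 §1ter (d)): state = (counter,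
  last `d` input bits), `walkStep (x, r) b = (x + b, push r b)`.  Every state has at most two preimages (`card_fiber_walkStep_le_two`), so the
  nonexpansion / cube-sum bounds of `WalkTwoStepTransferMarkov.lean` apply to it (`abs_sum_pathVal_walk_le`); for `d = 0` it is rung (G)'s
  lazy walk on `ℤ_{M+1}`.  The counter along the trajectory is `x₀ + N(t)` (`traj_walkStep_fst`).
WHAT THIS IS NOT: no assignment of cuts to steps yet (that needs the lift `w'` and `WalkTwoStepPartLocality`), no contraction; separation NOT moved.
-/

namespace Summit.QuantumAdvantage.AdviceFreeQNC0.LocalEngine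

open Finset Classical

/-! ### Trajectories of the generic automaton -/

section Traj

variable {St : Type*}

/-- The state after `i` steps from `σ` at time `t`, driven by the bit stream `u : ℕ → Bool`. -/
def traj (δ : ℕ → St → Bool → St) (t : ℕ) (σ : St) (u : ℕ → Bool) : ℕ → St
  | 0 => σ
  | i + 1 => δ (t + i) (traj δ t σ u i) (u (t + i))

/-- `traj` from the next state is `traj` shifted by one. -/
theorem traj_succ_shift (δ : ℕ → St → Bool → St) (t : ℕ) (σ : St) (u : ℕ → Bool) :
    ∀ i, traj δ (t + 1) (δ t σ (u t)) u i = traj δ t σ u (i + 1)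
  | 0 => by simp [traj]
  | i + 1 => by
      show δ (t + 1 + i) (traj δ (t + 1) (δ t σ (u t)) u i) (u (t + 1 + i))
        = δ (t + (i + 1)) (traj δ t σ u (i + 1)) (u (t + (i + 1)))
      rw [traj_succ_shift δ t σ u i, Nat.add_right_comm t 1 i, Nat.add_assoc]

/-- **The signed path value is the product of the edge weights along the trajectory times the final weight.**  (`u` is read at the
absolute times `t, …, t + m − 1`.) -/
theorem pathVal_eq_prod_traj (δ : ℕ → St → Bool → St) (s : ℕ → St → Bool → ℝ) :
    ∀ (m t : ℕ) (σ : St) (u : ℕ → Bool) (φ : St → ℝ),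
      pathVal δ s t m σ (fun i : Fin m => u (t + i.val)) φ
        = (∏ i ∈ Finset.range m, s (t + i) (traj δ t σ u i) (u (t + i))) * φ (traj δ t σ u m)
  | 0, t, σ, u, φ => by simp [pathVal, traj]
  | m + 1, t, σ, u, φ => by
      have e : (fun i : Fin (m + 1) => u (t + i.val)) = Fin.cons (u t) (fun i : Fin m => u (t + 1 + i.val)) := by
        funext i
        refine Fin.cases ?_ (fun j => ?_) i
        · simp
        · simp only [Fin.cons_succ, Fin.val_succ]; ring_nf
      rw [e, pathVal_cons, pathVal_eq_prod_traj δ s m (t + 1) (δ t σ (u t)) u φ, Finset.prod_range_succ', traj]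
      simp only [traj_succ_shift, Nat.add_zero]
      have e2 : ∀ i, t + 1 + i = t + (i + 1) := fun i => by ring
      simp only [e2]
      ring

end Traj

/-! ### The walk automaton with a `d`-bit register -/

section Walk

variable {M d : ℕ}

/-- Shift the register and append the new bit at the end. -/
def push (r : Fin d → Bool) (b : Bool) : Fin d → Bool :=
  fun i => if h : i.val + 1 < d then r ⟨i.val + 1, h⟩ else b

/-- One step of the walk automaton: the counter advances by the bit, the register records it. -/
def walkStep (σ : ZMod (M + 1) × (Fin d → Bool)) (b : Bool) : ZMod (M + 1) × (Fin d → Bool) :=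
  (σ.1 + ((b.toNat : ℕ) : ZMod (M + 1)), push σ.2 b)

/-- The appended bit is recovered from the new register (when `d ≥ 1`). -/
theorem push_apply_last (r : Fin d → Bool) (b : Bool) (hd : 0 < d) : push r b ⟨d - 1, by omega⟩ = b := by
  unfold push
  rw [dif_neg (by simp only; omega)]

/-- All but the dropped bit are recovered from the new register. -/
theorem push_apply_succ (r : Fin d → Bool) (b : Bool) (i : Fin d) (h : i.val + 1 < d) : push r b i = r ⟨i.val + 1, h⟩ := by
  unfold push
  rw [dif_pos h]

/-- **Every state of the walk automaton has at most two preimages** (the dropped register bit, or the input bit when `d = 0`). -/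
theorem card_fiber_walkStep_le_two (σ' : ZMod (M + 1) × (Fin d → Bool)) :
    ((univ : Finset ((ZMod (M + 1) × (Fin d → Bool)) × Bool)).filter fun q => walkStep q.1 q.2 = σ').card ≤ 2 := by
  -- the map `q ↦ (dropped bit if d ≥ 1, else the input bit)` is injective on the fibre
  set key : (ZMod (M + 1) × (Fin d → Bool)) × Bool → Bool := fun q =>
    if h : 0 < d then q.1.2 ⟨0, h⟩ else q.2 with hkey
  have hinj : Set.InjOn key ↑((univ : Finset ((ZMod (M + 1) × (Fin d → Bool)) × Bool)).filter fun q => walkStep q.1 q.2 = σ') := by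
    intro q hq q' hq' hk
    rw [Finset.coe_filter, Set.mem_setOf_eq] at hq hq'
    obtain ⟨-, hq⟩ := hq
    obtain ⟨-, hq'⟩ := hq'
    have h1 := hq.trans hq'.symm
    unfold walkStep at h1
    simp only [Prod.mk.injEq] at h1
    obtain ⟨hx, hr⟩ := h1
    -- the input bits agree
    have hb : q.2 = q'.2 := by
      by_cases hd : 0 < d
      · have e1 := push_apply_last q.1.2 q.2 hd
        have e2 := push_apply_last q'.1.2 q'.2 hd
        rw [hr] at e1
        exact e1.symm.trans e2
      · simp only [hkey, dif_neg hd] at hk; exact hk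
    -- the registers agree
    have hreg : q.1.2 = q'.1.2 := by
      funext i
      by_cases hi : i.val = 0
      · by_cases hd : 0 < d
        · simp only [hkey, dif_pos hd] at hk
          have ei : i = ⟨0, hd⟩ := Fin.ext hi
          rw [ei]; exact hk
        · exact absurd i.isLt (by omega)
      · have hi' : (i.val - 1) + 1 < d := by have := i.isLt; omega
        have e1 := push_apply_succ q.1.2 q.2 ⟨i.val - 1, by omega⟩ hi'
        have e2 := push_apply_succ q'.1.2 q'.2 ⟨i.val - 1, by omega⟩ hi'
        rw [hr] at e1
        have ei : (⟨i.val - 1 + 1, hi'⟩ : Fin d) = i := Fin.ext (by simp only; omega)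
        rw [ei] at e1 e2
        exact e1.symm.trans e2
    -- the counters agree
    have hcnt : q.1.1 = q'.1.1 := by rw [hb] at hx; exact add_right_cancel hx
    exact Prod.ext (Prod.ext hcnt hreg) hb
  have h := Finset.card_le_card_of_injOn key (fun q _ => Finset.mem_univ (key q)) hinj
  simpa using h

/-- Hence the cube sum of signed path values of the walk automaton is at most `2^m · √(Σ φ²)` for ANY `±1`-bounded time-dependent weights. -/
theorem abs_sum_pathVal_walk_le (s : ℕ → (ZMod (M + 1) × (Fin d → Bool)) → Bool → ℝ) (hs : ∀ t σ b, |s t σ b| ≤ 1)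
    (m t : ℕ) (σ : ZMod (M + 1) × (Fin d → Bool)) (φ : (ZMod (M + 1) × (Fin d → Bool)) → ℝ) :
    |∑ u : Fin m → Bool, pathVal (fun _ => walkStep) s t m σ u φ| ≤ (2 : ℝ) ^ m * Real.sqrt (sumSq φ) :=
  abs_sum_pathVal_le_of_fiber (fun _ => walkStep) s (fun _ σ' => card_fiber_walkStep_le_two σ') hs m t σ φ

/-- **The counter along the trajectory is `x₀ + N(t)`**: after `i` steps from time `0` the first component is `x₀ + #{j < i : u j}`. -/
theorem traj_walkStep_fst (x₀ : ZMod (M + 1)) (r₀ : Fin d → Bool) (u : ℕ → Bool) :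
    ∀ i, (traj (fun _ => (walkStep : ZMod (M + 1) × (Fin d → Bool) → Bool → _)) 0 (x₀, r₀) u i).1
      = x₀ + (((Finset.range i).filter fun j => u j = true).card : ℕ) := by
  intro i
  induction i with
  | zero => simp [traj]
  | succ i ih =>
      rw [traj, walkStep, ih, Finset.range_add_one, Finset.filter_insert]
      simp only [Nat.zero_add]
      by_cases hu : u i = true
      · rw [if_pos hu, Finset.card_insert_of_notMem (by simp), hu]
        push_cast; simp [Bool.toNat_true]; ring
      · rw [if_neg hu]
        have hf : u i = false := by simpa using hu
        rw [hf]; simp [Bool.toNat_false]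

/-- **The register along the trajectory holds the last `d` bits**: after `i ≥ d` steps, register slot `k` is the input bit `u (i − d + k)`. -/
theorem traj_walkStep_snd (x₀ : ZMod (M + 1)) (r₀ : Fin d → Bool) (u : ℕ → Bool) :
    ∀ i, d ≤ i → ∀ k : Fin d,
      (traj (fun _ => (walkStep : ZMod (M + 1) × (Fin d → Bool) → Bool → _)) 0 (x₀, r₀) u i).2 k = u (i - d + k.val) := by
  -- strengthen: for every `i` and every slot `k` with `i + k ≥ d` (the slot already holds an input bit)
  suffices h : ∀ i (k : Fin d), d ≤ i + k.val →
      (traj (fun _ => (walkStep : ZMod (M + 1) × (Fin d → Bool) → Bool → _)) 0 (x₀, r₀) u i).2 k = u (i + k.val - d) by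
    intro i hi k
    rw [h i k (by omega)]
    congr 1; omega
  intro i
  induction i with
  | zero => intro k hk; exact absurd k.isLt (by omega)
  | succ i ih =>
      intro k hk
      rw [traj, walkStep]
      simp only [Nat.zero_add]
      by_cases hlast : k.val + 1 < d
      · rw [push_apply_succ _ _ k hlast, ih ⟨k.val + 1, hlast⟩ (by simp only; omega)]
        congr 1; simp only; omega
      · unfold push
        rw [dif_neg hlast]
        congr 1; omega

end Walk

end Summit.QuantumAdvantage.AdviceFreeQNC0.LocalEngine
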